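import Summits.QuantumFields.YangMills.Theorems.AlphaInputsT3ACv3NewtonLiftFramedLinearisation
import Summits.QuantumFields.YangMills.Theorems.AlphaInputsT3ACv3LinearLiftMatrixKernel
import HarnessLib

/-!
# `AlphaInputsT3ACv3NewtonLiftTwistedKernel` — STRATEGY B for 2′, the (FL) row under OWNER RULING g24-№4, residual (r1) with the kernel of record (r1-ob): **THE KERNEL ROWS OF THE
# REGIONAL NEWTON LIFT FOR AN ABSTRACT TWISTED KERNEL `byEntryTw T ψ`, READ IN A LOCAL GAUGE** — the covariance identity, row (iii) (sup), row (ii) (approximate right inverse of the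
# FRAMED linearisation) and the curl row in the gauge, for ANY linear scalar kernel `T` with ★w3's three scalar hypotheses (E) exactness ∕ (B) local sup bound on a support `N b` ∕ (C)
# local curl bound — so that ★alpha-2 g6's one-block `obLift`, ★w2 g2's `liftS`, or any re-weighted kernel feeds `NewtonLiftFramed.exists_exact_lift_regional_allL` by `exact` —
# lane `pub-balaban3d` ∕ cell `ym3-torus`, seat `ym-ust-19936-w4` (g2)

WHY (cell `ym3-torus` 2026-08-28: ★★OWNER g25 03:01:17Z∕03:02:25Z «(r1-ob): kernel of record := `obLift` … rows (ii)∕curl by (C)'s pattern with θ, θ′ over one block … ★w4 keep `R₀`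
abstract»; ★w3 g0 p600296 `…LinearLiftMatrixKernel` = the abstract kernel port with GLOBAL-in-`b` frame hypotheses on the support).  `…NewtonLiftFramedInverse` (this seat, p599945) did the
local-gauge reading for `liftSMTw` by name; THIS FILE repeats it for the ABSTRACT twisted kernel of ★w3's part 12, so the `obLift` port needs no new argument:
* §1 ★★ `conj_byEntryTw_eq` — COVARIANCE: `g(b₋)·(byEntryTw T ψ u)(b)·g(b₋)* = byEntryTw T ψ′ u′ (b)` for rotated frames∕data agreeing with `Ad(g(b₋)) ∘ ψ(b,c′) ∘ Ad(h_{c′})⁻¹`, `h u h*`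
  on the support `N b`; `norm_byEntryTw_le_sup` — ROW (iii): `‖byEntryTw T ψ u‖ ≤ ρ·‖u‖` for contractive frames.
* §2 ★★★ `norm_framedAvg_byEntryTw_sub_le` — ROW (ii) in the gauge `g`: `‖h_c*·Q^{(k)}(g·(byEntryTw T ψ u)·g*)(c)·h_c − u(c)‖ ≤ ((d+1)L^k)·(ρ·(θ·M))` as soon as the ROTATED frames are
  `θ`-close to the identity for the bonds `b` of the two `k`-blocks of `c` and `c′ ∈ N b` — k-UNIFORM when `ρ = C∕L^k` (doctored frames + `linAvgIterM_congr₂` + ★w3's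
  `norm_linAvgIterM_byEntryTw_sub_le_of_exact`).
* §3 ★★ `norm_curlM_conj_byEntryTw_le` — THE CURL ROW in the gauge `g`: `‖curl(g·(byEntryTw T ψ u)·g*)(x;μ,ν)‖ ≤ ρ′·M + 3ρ·(θ′·M)` as soon as `ψ` is contractive and the rotated frames are
  `θ′`-frozen between the base bond and the other three bonds on their supports (doctored frames on the union of the four supports + ★w3's `norm_curlM_byEntryTw_le`).
HONEST FRAMING.  Finite-dimensional linear algebra; the kernel `T`, its constants `ρ, ρ′`, the gauges and the oscillations `θ, θ′` are INPUTS; nothing of [Balaban1985UV3]∕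
[Balaban1985Variational]∕[Balaban1985Averaging] is asserted; (FL)∕`hLift`, the stub 2′χ, the crux and any gap are NOT claimed; count-neutral helper toward R3 2′ (items 19936∕19935);
registry untouched; nothing about d = 4, the continuum, or a mass gap; YM₃ on T³ is rung R3, not Clay.

References: T. Bałaban, Commun. Math. Phys. 98 (1985) 17–51 [Balaban1985Averaging] ((9)+(11)–(13) pp.18–19, (19) p.21, p.24); CMP 109 (1987) 249–301 [Balaban1987RG1] ((0.4), (0.11) p.253).
-/

set_option autoImplicit false

noncomputable section

open scoped Matrix.Norms.L2Operator Classical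
open NormedSpace
namespace Summit.QuantumFields.YangMills.Theorems.NewtonLiftFramed

open Finset
open Literature.MathematicalPhysics.QuantumFieldTheory.Balaban1983to89
open Literature.MathematicalPhysics.QuantumFieldTheory.Balaban1983to89.B5Eq118OneStroke (iterBlockOf)
open T4Continuum
open Summit.QuantumFields.YangMills.Theorems.AbelianEML (linAvgIter curlAt)
open Summit.QuantumFields.YangMills.Theorems.LinearLiftMatrix (byEntryTw byEntryTw_def kernel_eq_zero_of_bound linAvgIterM curlM norm_byEntryTw_le_of_bound
  norm_linAvgIterM_byEntryTw_sub_le_of_exact norm_curlM_byEntryTw_le)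
open Summit.QuantumFields.YangMills.Theorems.PerturbedPlaquette (norm_conj_SU)
open Summit.QuantumFields.YangMills.Theorems.Prop7HolRatioPerStep (coe_star_mul_self coe_mul_star_self)

variable {n : Type*} [Fintype n] [DecidableEq n] {P : Params} {k : ℕ}
variable (T : (PBond P k → ℝ) →ₗ[ℝ] (PBond P 0 → ℝ)) (N : PBond P 0 → PBond P k → Prop) {ρ : ℝ}
  (hB : ∀ (f : PBond P k → ℝ) (M : ℝ) (b : PBond P 0), (∀ c, N b c → |f c| ≤ M) → |T f b| ≤ ρ * M)

/-! ## §1 Covariance of the twisted kernel under a gauge transformation; row (iii) -/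

section Kernel

include hB

/-- **★★ THE COVARIANCE IDENTITY OF AN ABSTRACT TWISTED KERNEL**: for a finest gauge transformation `g` and unitaries `h_{c′}` at the coarse bonds, conjugating at `b₋` is applying the
kernel to the rotated data with the rotated frames: `g(b₋)·(byEntryTw T ψ u)(b)·g(b₋)* = byEntryTw T ψ′ u′ (b)` whenever `ψ′ b c′ Y = g(b₋)·ψ b c′ (h_{c′}*·Y·h_{c′})·g(b₋)*` and
`u′ c′ = h_{c′}·u c′·h_{c′}*` ON THE SUPPORT `N b` (the kernel vanishes beyond, by (B)). [cite: Balaban1985Averaging, (11)–(13) p.19, p.24] -/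
theorem conj_byEntryTw_eq (ψ ψ' : PBond P 0 → PBond P k → Matrix n n ℂ →ₗ[ℝ] Matrix n n ℂ) (g : GaugeTransf P 0 (Matrix.specialUnitaryGroup n ℂ))
    (h : PBond P k → Matrix.specialUnitaryGroup n ℂ) (u u' : PBond P k → Matrix n n ℂ) (b : PBond P 0)
    (hψ' : ∀ (c' : PBond P k) (Y : Matrix n n ℂ), N b c' →
      ψ' b c' Y = (g b.src : Matrix n n ℂ) * ψ b c' (star (h c' : Matrix n n ℂ) * Y * (h c' : Matrix n n ℂ)) * star (g b.src : Matrix n n ℂ))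
    (hu' : ∀ c' : PBond P k, N b c' → u' c' = (h c' : Matrix n n ℂ) * u c' * star (h c' : Matrix n n ℂ)) :
    (g b.src : Matrix n n ℂ) * byEntryTw T ψ u b * star (g b.src : Matrix n n ℂ) = byEntryTw T ψ' u' b := by
  classical
  rw [byEntryTw_def, byEntryTw_def, mul_sum, sum_mul]
  refine sum_congr rfl fun c' _ => ?_
  by_cases hc : N b c'
  · rw [hψ' c' _ hc, hu' c' hc, mul_smul_comm, smul_mul_assoc]
    congr 1
    have f : star (h c' : Matrix n n ℂ) * ((h c' : Matrix n n ℂ) * u c' * star (h c' : Matrix n n ℂ)) * (h c' : Matrix n n ℂ) =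
        (star (h c' : Matrix n n ℂ) * (h c' : Matrix n n ℂ)) * u c' * (star (h c' : Matrix n n ℂ) * (h c' : Matrix n n ℂ)) := by noncomm_ring
    rw [f, coe_star_mul_self, one_mul, mul_one]
  · rw [kernel_eq_zero_of_bound T (N b) b (fun f M' hf => hB f M' b hf) hc, zero_smul, zero_smul, mul_zero, zero_mul]

/-- **ROW (iii) — THE SUP-NORM READING**: for contractive frames, `‖byEntryTw T ψ u‖ ≤ ρ·‖u‖` (sup norms). [cite: Balaban1987RG1, (0.4)+(0.11) p.253] -/
theorem norm_byEntryTw_le_sup (hρ : 0 ≤ ρ) (ψ : PBond P 0 → PBond P k → Matrix n n ℂ →ₗ[ℝ] Matrix n n ℂ) (hψ : ∀ b c X, ‖ψ b c X‖ ≤ ‖X‖) (u : PBond P k → Matrix n n ℂ) :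
    ‖byEntryTw T ψ u‖ ≤ ρ * ‖u‖ :=
  (pi_norm_le_iff_of_nonneg (mul_nonneg hρ (norm_nonneg _))).2 fun b =>
    norm_byEntryTw_le_of_bound T ψ (N b) b (fun f M' hf => hB f M' b hf) (fun c _ X => hψ b c X) u (norm_nonneg u) fun c _ => norm_le_pi_norm u c

end Kernel

/-! ## §2 Row (ii) in the local gauge -/

section RowTwo

variable [Nonempty n] (hk : k ≤ P.m + P.K)
include hB hk

/-- **★★★ ROW (ii) OF THE REGIONAL SHELL FOR AN ABSTRACT TWISTED KERNEL, IN THE LOCAL GAUGE `g`** (`k ≤ m + K`).  Kernel `T` exact ((E) `linAvgIter k (T f) = f`) with the local sup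
bound (B) on the support `N b`; frames `ψ`; a finest gauge transformation `g` with restricted gauge `h_{c′} = g^{(k)}(c′₋)`; data `‖u c′‖ ≤ M`.  If the ROTATED frames are `θ`-close to the
identity ON THE PAIRS READ AT `c` — for every finest bond `b` with both ends in the two `k`-blocks of `c` and every `c′ ∈ N b`, `‖g(b₋)·ψ b c′ (h_{c′}*·Y·h_{c′})·g(b₋)* − Y‖ ≤ θ‖Y‖` — then
`‖h_c*·Q^{(k)}(b ↦ g(b₋)·(byEntryTw T ψ u)(b)·g(b₋)*)(c)·h_c − u(c)‖ ≤ ((d+1)L^k)·(ρ·(θ·M))`; k-UNIFORM when `ρ = C∕L^k` (one-block `obLift`: `C ≈ 20`; `liftS`: `C = C_S`).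
[cite: Balaban1985Averaging, (11)–(13) p.19; Balaban1987RG1, (0.4)+(0.11) p.253] -/
theorem norm_framedAvg_byEntryTw_sub_le (hE : ∀ f, linAvgIter k (T f) = f) (c : PBond P k) (ψ : PBond P 0 → PBond P k → Matrix n n ℂ →ₗ[ℝ] Matrix n n ℂ)
    (g : GaugeTransf P 0 (Matrix.specialUnitaryGroup n ℂ)) (u : PBond P k → Matrix n n ℂ) {M θ : ℝ} (hM : ∀ c', ‖u c'‖ ≤ M) (hθ : 0 ≤ θ)
    (hψ : ∀ b : PBond P 0, (iterBlockOf k b.src = c.src ∨ iterBlockOf k b.src = c.tgt) → (iterBlockOf k b.tgt = c.src ∨ iterBlockOf k b.tgt = c.tgt) →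
      ∀ c' : PBond P k, N b c' → ∀ Y : Matrix n n ℂ,
        ‖(g b.src : Matrix n n ℂ) * ψ b c' (star (transfUp g k c'.src : Matrix n n ℂ) * Y * (transfUp g k c'.src : Matrix n n ℂ)) * star (g b.src : Matrix n n ℂ) - Y‖ ≤ θ * ‖Y‖) :
    ‖star (transfUp g k c.src : Matrix n n ℂ) * linAvgIterM k (fun b => (g b.src : Matrix n n ℂ) * byEntryTw T ψ u b * star (g b.src : Matrix n n ℂ)) c *
        (transfUp g k c.src : Matrix n n ℂ) - u c‖ ≤ (((P.d : ℝ) + 1) * (P.L : ℝ) ^ k) * (ρ * (θ * M)) := by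
  classical
  -- the rotated data and the doctored rotated frames
  let Rd : PBond P 0 → Prop := fun b => (iterBlockOf k b.src = c.src ∨ iterBlockOf k b.src = c.tgt) ∧ (iterBlockOf k b.tgt = c.src ∨ iterBlockOf k b.tgt = c.tgt)
  let u' : PBond P k → Matrix n n ℂ := fun c' => (transfUp g k c'.src : Matrix n n ℂ) * u c' * star (transfUp g k c'.src : Matrix n n ℂ)
  let ψg : PBond P 0 → PBond P k → Matrix n n ℂ →ₗ[ℝ] Matrix n n ℂ := fun b c' =>
    (LinearMap.mulLeftRight ℝ ((g b.src : Matrix n n ℂ), star (g b.src : Matrix n n ℂ))).comp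
      ((ψ b c').comp (LinearMap.mulLeftRight ℝ (star (transfUp g k c'.src : Matrix n n ℂ), (transfUp g k c'.src : Matrix n n ℂ))))
  have hψg : ∀ (b : PBond P 0) (c' : PBond P k) (Y : Matrix n n ℂ),
      ψg b c' Y = (g b.src : Matrix n n ℂ) * ψ b c' (star (transfUp g k c'.src : Matrix n n ℂ) * Y * (transfUp g k c'.src : Matrix n n ℂ)) * star (g b.src : Matrix n n ℂ) := by
    intro b c' Y
    simp only [ψg, LinearMap.comp_apply, LinearMap.mulLeftRight_apply]
  let ψd : PBond P 0 → PBond P k → Matrix n n ℂ →ₗ[ℝ] Matrix n n ℂ := fun b c' => if Rd b ∧ N b c' then ψg b c' else LinearMap.id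
  have hψd : ∀ b c' Y, N b c' → ‖ψd b c' Y - Y‖ ≤ θ * ‖Y‖ := by
    intro b c' Y hc
    by_cases hb : Rd b ∧ N b c'
    · have e : ψd b c' = ψg b c' := if_pos hb
      rw [e, hψg]; exact hψ b hb.1.1 hb.1.2 c' hb.2 Y
    · have e : ψd b c' = LinearMap.id := if_neg hb
      rw [e, LinearMap.id_apply, sub_self, norm_zero]; positivity
  have hu' : ∀ c', ‖u' c'‖ ≤ M := fun c' => by simp only [u']; rw [norm_conj_SU]; exact hM c'
  -- covariance on the bonds read at `c`, then two-block locality of `Q^{(k)}`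
  have hcov : ∀ b : PBond P 0, Rd b → (g b.src : Matrix n n ℂ) * byEntryTw T ψ u b * star (g b.src : Matrix n n ℂ) = byEntryTw T ψd u' b := by
    intro b hb
    refine conj_byEntryTw_eq T N hB ψ ψd g (fun c' => transfUp g k c'.src) u u' b (fun c' Y hc => ?_) (fun c' _ => rfl)
    have e : ψd b c' = ψg b c' := if_pos ⟨hb, hc⟩
    rw [e, hψg]
  have hloc : linAvgIterM k (fun b => (g b.src : Matrix n n ℂ) * byEntryTw T ψ u b * star (g b.src : Matrix n n ℂ)) c = linAvgIterM k (byEntryTw T ψd u') c :=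
    linAvgIterM_congr₂ hk _ _ c fun b h1 h2 => hcov b ⟨h1, h2⟩
  -- ★w3's exactness defect for the doctored frames, rotated back
  have hw3 := norm_linAvgIterM_byEntryTw_sub_le_of_exact k T N hB hE ψd hθ (fun b c' X hc => hψd b c' X hc) u' hu' c
  rw [hloc, norm_sub_rev, norm_sub_conj_eq, norm_sub_rev]
  exact hw3

end RowTwo

/-! ## §3 The curl row in the local gauge -/

section Curl

include hB

/-- **★★ THE CURL ROW OF AN ABSTRACT TWISTED KERNEL, IN THE LOCAL GAUGE `g`.**  Kernel `T` with the local sup bound (B) on `N b` and a local scalar curl bound (C) at the plaquette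
`(x; μ, ν)` on a support `N_c` (`|curlAt (T f) x μ ν| ≤ ρ′·M` from `|f| ≤ M` on `N_c`); CONTRACTIVE frames `ψ`; a finest gauge transformation `g`, `h_{c′} = g^{(k)}(c′₋)`; data
`‖u c′‖ ≤ M`.  If the ROTATED frames `ψ^g(b,c′)Y = g(b₋)·ψ b c′(h_{c′}*Yh_{c′})·g(b₋)*` are `θ′`-frozen between the base bond `b₁ = (x,μ)` and each other bond `bᵢ` of the plaquette ON
`bᵢ`'s SUPPORT (`‖ψ^g(bᵢ,c′)Y − ψ^g(b₁,c′)Y‖ ≤ θ′‖Y‖` for `c′ ∈ N bᵢ`), then `‖curl(b ↦ g(b₋)·(byEntryTw T ψ u)(b)·g(b₋)*)(x;μ,ν)‖ ≤ ρ′·M + 3·(ρ·(θ′·M))`.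
[cite: Balaban1985Averaging, (9)+(11) pp.18–19; Balaban1987RG1, (0.4)+(0.11) p.253] -/
theorem norm_curlM_conj_byEntryTw_le (Nc : PBond P k → Prop) (x : Site P 0) {μ ν : Fin P.d} {ρ' : ℝ}
    (hC : ∀ (f : PBond P k → ℝ) (M : ℝ), (∀ c, Nc c → |f c| ≤ M) → |curlAt (T f) x μ ν| ≤ ρ' * M)
    (ψ : PBond P 0 → PBond P k → Matrix n n ℂ →ₗ[ℝ] Matrix n n ℂ) (hψc : ∀ b c X, ‖ψ b c X‖ ≤ ‖X‖)
    (g : GaugeTransf P 0 (Matrix.specialUnitaryGroup n ℂ)) (u : PBond P k → Matrix n n ℂ) {M θ' : ℝ} (hM : ∀ c', ‖u c'‖ ≤ M) (hθ' : 0 ≤ θ')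
    (hψ : ∀ b : PBond P 0, (b = ⟨x.shift μ, ν⟩ ∨ b = ⟨x.shift ν, μ⟩ ∨ b = ⟨x, ν⟩) → ∀ c' : PBond P k, N b c' → ∀ Y : Matrix n n ℂ,
      ‖(g b.src : Matrix n n ℂ) * ψ b c' (star (transfUp g k c'.src : Matrix n n ℂ) * Y * (transfUp g k c'.src : Matrix n n ℂ)) * star (g b.src : Matrix n n ℂ) -
          (g x : Matrix n n ℂ) * ψ ⟨x, μ⟩ c' (star (transfUp g k c'.src : Matrix n n ℂ) * Y * (transfUp g k c'.src : Matrix n n ℂ)) * star (g x : Matrix n n ℂ)‖ ≤ θ' * ‖Y‖) :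
    ‖curlM (fun b => (g b.src : Matrix n n ℂ) * byEntryTw T ψ u b * star (g b.src : Matrix n n ℂ)) x μ ν‖ ≤ ρ' * M + 3 * (ρ * (θ' * M)) := by
  classical
  -- the rotated data and the doctored rotated frames (rotated on the union of the four supports, trivial elsewhere)
  let u' : PBond P k → Matrix n n ℂ := fun c' => (transfUp g k c'.src : Matrix n n ℂ) * u c' * star (transfUp g k c'.src : Matrix n n ℂ)
  let ψg : PBond P 0 → PBond P k → Matrix n n ℂ →ₗ[ℝ] Matrix n n ℂ := fun b c' =>
    (LinearMap.mulLeftRight ℝ ((g b.src : Matrix n n ℂ), star (g b.src : Matrix n n ℂ))).comp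
      ((ψ b c').comp (LinearMap.mulLeftRight ℝ (star (transfUp g k c'.src : Matrix n n ℂ), (transfUp g k c'.src : Matrix n n ℂ))))
  have hψg : ∀ (b : PBond P 0) (c' : PBond P k) (Y : Matrix n n ℂ),
      ψg b c' Y = (g b.src : Matrix n n ℂ) * ψ b c' (star (transfUp g k c'.src : Matrix n n ℂ) * Y * (transfUp g k c'.src : Matrix n n ℂ)) * star (g b.src : Matrix n n ℂ) := by
    intro b c' Y
    simp only [ψg, LinearMap.comp_apply, LinearMap.mulLeftRight_apply]
  let U4 : PBond P k → Prop := fun c' => N ⟨x, μ⟩ c' ∨ N ⟨x.shift μ, ν⟩ c' ∨ N ⟨x.shift ν, μ⟩ c' ∨ N ⟨x, ν⟩ c'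
  let ψd : PBond P 0 → PBond P k → Matrix n n ℂ →ₗ[ℝ] Matrix n n ℂ := fun b c' => if U4 c' then ψg b c' else LinearMap.id
  have hψd_of : ∀ b c', U4 c' → ψd b c' = ψg b c' := fun b c' hc => if_pos hc
  have hψd_not : ∀ b c', ¬ U4 c' → ψd b c' = LinearMap.id := fun b c' hc => if_neg hc
  have hψgc : ∀ b c' Y, ‖ψg b c' Y‖ ≤ ‖Y‖ := by
    intro b c' Y
    rw [hψg, norm_conj_SU]
    refine (hψc b c' _).trans (le_of_eq ?_)
    rw [CStarRing.norm_mul_mem_unitary _ (transfUp g k c'.src).2.1, CStarRing.norm_mem_unitary_mul _ (Unitary.star_mem (transfUp g k c'.src).2.1)]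
  have hψdc : ∀ b c' Y, ‖ψd b c' Y‖ ≤ ‖Y‖ := by
    intro b c' Y
    by_cases hc : U4 c'
    · rw [hψd_of b c' hc]; exact hψgc b c' Y
    · rw [hψd_not b c' hc, LinearMap.id_apply]
  have hfro : ∀ b : PBond P 0, (b = ⟨x.shift μ, ν⟩ ∨ b = ⟨x.shift ν, μ⟩ ∨ b = ⟨x, ν⟩) → ∀ c' Y, N b c' → ‖ψd b c' Y - ψd ⟨x, μ⟩ c' Y‖ ≤ θ' * ‖Y‖ := by
    intro b hb c' Y hc
    have hU : U4 c' := by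
      rcases hb with e | e | e
      · subst e; exact Or.inr (Or.inl hc)
      · subst e; exact Or.inr (Or.inr (Or.inl hc))
      · subst e; exact Or.inr (Or.inr (Or.inr hc))
    rw [hψd_of b c' hU, hψd_of _ c' hU, hψg, hψg]; exact hψ b hb c' hc Y
  have hu' : ∀ c', ‖u' c'‖ ≤ M := fun c' => by simp only [u']; rw [norm_conj_SU]; exact hM c'
  -- covariance on the four bonds
  have hcov : ∀ b : PBond P 0, (∀ c', N b c' → U4 c') → (g b.src : Matrix n n ℂ) * byEntryTw T ψ u b * star (g b.src : Matrix n n ℂ) = byEntryTw T ψd u' b := by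
    intro b hb
    refine conj_byEntryTw_eq T N hB ψ ψd g (fun c' => transfUp g k c'.src) u u' b (fun c' Y hc => ?_) (fun c' _ => rfl)
    rw [hψd_of b c' (hb _ hc), hψg]
  set F : PBond P 0 → Matrix n n ℂ := fun b => (g b.src : Matrix n n ℂ) * byEntryTw T ψ u b * star (g b.src : Matrix n n ℂ) with hF
  have h1 : F ⟨x, μ⟩ = byEntryTw T ψd u' ⟨x, μ⟩ := hcov ⟨x, μ⟩ fun c' hc => Or.inl hc
  have h2 : F ⟨x.shift μ, ν⟩ = byEntryTw T ψd u' ⟨x.shift μ, ν⟩ := hcov ⟨x.shift μ, ν⟩ fun c' hc => Or.inr (Or.inl hc)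
  have h3 : F ⟨x.shift ν, μ⟩ = byEntryTw T ψd u' ⟨x.shift ν, μ⟩ := hcov ⟨x.shift ν, μ⟩ fun c' hc => Or.inr (Or.inr (Or.inl hc))
  have h4 : F ⟨x, ν⟩ = byEntryTw T ψd u' ⟨x, ν⟩ := hcov ⟨x, ν⟩ fun c' hc => Or.inr (Or.inr (Or.inr hc))
  have e : curlM F x μ ν = curlM (byEntryTw T ψd u') x μ ν := by
    rw [show curlM F x μ ν = F ⟨x, μ⟩ + F ⟨x.shift μ, ν⟩ - F ⟨x.shift ν, μ⟩ - F ⟨x, ν⟩ from rfl, h1, h2, h3, h4]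
    rfl
  rw [e]
  exact norm_curlM_byEntryTw_le k T N hB Nc x hC ψd hψdc u' hu' hθ' (fun c' X hc => hfro _ (Or.inl rfl) c' X hc)
    (fun c' X hc => hfro _ (Or.inr (Or.inl rfl)) c' X hc) (fun c' X hc => hfro _ (Or.inr (Or.inr rfl)) c' X hc)

end Curl

end Summit.QuantumFields.YangMills.Theorems.NewtonLiftFramed

end
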